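import Summits.RiemannHypothesis.RiemannHypothesis.Theorems.WeilFormatCCinfImageCoeffBox
import Summits.RiemannHypothesis.RiemannHypothesis.Theorems.WeilFormatCCinfImageCoeffBoxOdd
import Summits.RiemannHypothesis.RiemannHypothesis.Theorems.WeilFormatCPolyWindowPoleBox
import Literature.Analysis.ValidatedNumerics.BernoulliNumbersTable
import HarnessLib

/-!
# Format C, design C∞ (E2 data side): the IMAGE-INPUT producer — `CinfCoeff.ImgInputs` / `ImgInputsO` from certified constants

Route context: Fourier–Galerkin / Schur-complement certificates of Weil positivity on a window ("format C", C∞ door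
`WeilFormatC.weilPositivityOn_of_cinf_pipeline`; cell memo `run/shared/lean/pub/rh-explicit/rh-explicit-weil-10/KERNEL-LEVER.md` §24;
supporting stmt-RiemannHypothesis-0098; seat rh-explicit-weil-10).  The image primitives of the stage pipeline (`hPIN`, `hRTN`, `hRI`:
the collected images `CinfFam.pimgE/O`, the profile table `CinfFam.rtabE/O`, the image remainders `CinfFam.rhoImgE/O`) are boxed by
`CinfCoeff.mem_imgPure/Log/Cos/SinBox` (+ odd twins) from an input record `X : CinfCoeff.ImgInputs` under `CinfCoeff.ImgInputsValid S a q ν R X`.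
This file PRODUCES such records — the image analogue of rh-explicit-weil-2's row producer `CinfRowIn.ofRec`
(`WeilFormatCCinfCertRowInputs`) — from objects a format-C rung certifies by `decide +kernel`: the constants record `C` (`ConstsValid`:
prime weights/lengths, `π`, `1/π`, `log π`), boxes `Ep/Em ∋ e^{±a/2}` (`WinPole.expHalfBoxes`), the table of window constants
`W_l = ∫_{(0,2a]} ρ t^l` (`WinEntry.wtab`, as the mixed tables use it), the tail `T = ∫_{(2a,∞)} ρ` (`WinEntry.tailBox`), the Markov
constant (`WinEntry.markovBox`), boxes of `log 2`, `log a`, `Re ψ(¼)` (a table record at mode `0`), and the node-moment list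
(`CinfRowIn.momList` / `CinfCoeff.nodeMomentBox`).  Two fields are not plain kit constants and are boxed here first:

* the window bracket `K_{q,k}` (`CinfCoeff.Kbracket`; prime sum + archimedean window integral + tail/Markov part): `kReal`,
  `Kbracket_eq_ofReal` / `KbracketO_eq_ofReal`, `re_I_pow_mul_Kbracket` / `im_I_pow_mul_KbracketO`, `bracketPoly_eq_sum`
  (`(a^j − (a−t)^j) + ((−a+t)^j − (−a)^j) = Σ_{p<j} d_p t^{p+1}`), `primeKBox` / `archKBox` / ★ `kBox` + `mem_kBox`;
* the constant `κ_c = ½log(π/2a) − ½Re ψ(¼) − D_{−1}` with `D_{−1} = ∫_{(2a,∞)} ρ`: `kcBox` + `mem_kcBox`; `lamBox` + `mem_lamBox` (`ΣΛ/√n`);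
then `kreList` / `kimList` (the `KRe` fields), `ofConsts` / `ofConstsO` (the records) and ★ `valid_ofConsts` / `valid_ofConstsO`,
★ `valid_even` / `valid_odd` (every input from the kit objects at once).

Interval plumbing over landed evaluators; standard axioms; no RH claim.
-/

set_option autoImplicit false
-- `Summit.RiemannHypothesis.RiemannHypothesis.…` is the layout-mandated namespace (summit = problem name).
set_option linter.dupNamespace false

open Finset Complex MeasureTheory Set
open scoped Real ArithmeticFunction.vonMangoldt

namespace Summit.RiemannHypothesis.RiemannHypothesis.Theorems.WeilFormatC

open Literature.NumberTheory.LFunctions Literature.NumberTheory.LFunctions.Yoshida1992 Literature.Analysis.SpecialFunctions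
open Literature.Analysis.ValidatedNumerics Literature.Analysis.ValidatedNumerics.NumericsMP
open Literature.NumberTheory.LFunctions.Yoshida1992 (PrimeLen PrimeData)
open Literature.NumberTheory.LFunctions.Yoshida1992.Encl (Consts ConstsValid list_sum_map_eq_sum_range)

namespace CinfImgIn

open WinConst (ratBox mem_ratBox mulRatBox mem_mulRatBox)
open WinEntry (sumBox mem_sumBox wtab)
open CinfCoeff (powI mem_powI Kbracket KbracketO)

variable {S : ℕ}

/-! ## The window bracket as a real number -/

/-- The prime polynomial `P_j(a, ℓ) = (a^j − (−a)^j) + (a^j − (a−ℓ)^j) + ((−a+ℓ)^j − (−a)^j)`. -/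
noncomputable def primePoly (a : ℝ) (j : ℕ) (ℓ : ℝ) : ℝ :=
  (a ^ j - (-a) ^ j) + (a ^ j - (a - ℓ) ^ j) + ((-a + ℓ) ^ j - (-a) ^ j)

/-- The bracket polynomial `B_j(t) = (a^j − (a−t)^j) + ((−a+t)^j − (−a)^j)` (no constant term). -/
noncomputable def bracketPoly (a : ℝ) (j : ℕ) (t : ℝ) : ℝ :=
  (a ^ j - (a - t) ^ j) + ((-a + t) ^ j - (-a) ^ j)

/-- `K_{q,k}` (with `j = q − k`) as a real number: prime part + archimedean window integral + tail/Markov part. -/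
noncomputable def kReal (a : ℝ) (j : ℕ) : ℝ :=
  (∑ n ∈ weilPrimeIndex a, (Λ n : ℝ) / Real.sqrt n * primePoly a j (Real.log n))
    + (∫ t in Ioc 0 (2 * a), weilArchDensity t * bracketPoly a j t)
    + (2 * (∫ t in Ioi (2 * a), weilArchDensity t) - weilMarkovConstant a) * (a ^ j - (-a) ^ j)

/-- `Kbracket a q k = kReal a (q − k)` (as a complex number). -/
theorem Kbracket_eq_ofReal (a : ℝ) (q k : ℕ) : Kbracket a q k = ((kReal a (q - k) : ℝ) : ℂ) := by
  unfold Kbracket kReal primePoly bracketPoly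
  push_cast
  ring

/-- `KbracketO a q k = kReal a (q − k)`. -/
theorem KbracketO_eq_ofReal (a : ℝ) (q k : ℕ) : KbracketO a q k = ((kReal a (q - k) : ℝ) : ℂ) := by
  unfold KbracketO kReal primePoly bracketPoly
  push_cast
  ring

/-- `Re(i^{k+1} K_{q,k}) = c_{k+1} · K` with `c = (1, 0, −1, 0)` by `(k+1) mod 4`. -/
theorem re_I_pow_mul_Kbracket (a : ℝ) (q k : ℕ) :
    (I ^ (k + 1) * Kbracket a q k).re = ((CinfCoeff.cosQ (k + 1) : ℚ) : ℝ) * kReal a (q - k) := by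
  rw [Kbracket_eq_ofReal, Complex.re_mul_ofReal, CinfCoeff.cosQ_cast, I_pow_eq_I_pow_mod_four]
  have h4 : (k + 1) % 4 < 4 := Nat.mod_lt _ (by norm_num)
  interval_cases hm : (k + 1) % 4 <;> simp [pow_succ]

/-- `Im(i^{k+1} K_{q,k}) = σ_{k+1} · K` with `σ = (0, 1, 0, −1)` by `(k+1) mod 4`. -/
theorem im_I_pow_mul_KbracketO (a : ℝ) (q k : ℕ) :
    (I ^ (k + 1) * KbracketO a q k).im = ((CinfCoeff.sinQO (k + 1) : ℚ) : ℝ) * kReal a (q - k) := by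
  rw [KbracketO_eq_ofReal, Complex.im_mul_ofReal, CinfCoeff.sinQ_castO, I_pow_eq_I_pow_mod_four]
  have h4 : (k + 1) % 4 < 4 := Nat.mod_lt _ (by norm_num)
  interval_cases hm : (k + 1) % 4 <;> simp [pow_succ]

/-! ## The bracket polynomial as `Σ_{p<j} d_p t^{p+1}` -/

/-- The coefficients `d_p = C(j, p+1)·((−a)^{j−p−1} − (−1)^{p+1} a^{j−p−1})` (rational in `a`). -/
def bracketCoeff (a : ℚ) (j p : ℕ) : ℚ :=
  ((j.choose (p + 1) : ℕ) : ℚ) * ((-a) ^ (j - (p + 1)) - (-1) ^ (p + 1) * a ^ (j - (p + 1)))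

/-- **`B_j(t) = Σ_{p<j} d_p t^{p+1}`.** -/
theorem bracketPoly_eq_sum (a : ℚ) (j : ℕ) (t : ℝ) :
    bracketPoly (a : ℝ) j t = ∑ p ∈ Finset.range j, ((bracketCoeff a j p : ℚ) : ℝ) * t ^ (p + 1) := by
  unfold bracketPoly bracketCoeff
  have h1 : ((a : ℝ) - t) ^ j = ∑ m ∈ Finset.range (j + 1), (-t) ^ m * (a : ℝ) ^ (j - m) * (j.choose m : ℝ) := by
    rw [show (a : ℝ) - t = -t + a by ring, add_pow]
  have h2 : (-(a : ℝ) + t) ^ j = ∑ m ∈ Finset.range (j + 1), t ^ m * (-(a : ℝ)) ^ (j - m) * (j.choose m : ℝ) := by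
    rw [show -(a : ℝ) + t = t + -(a : ℝ) by ring, add_pow]
  rw [h1, h2, Finset.sum_range_succ' (fun m ↦ (-t) ^ m * (a : ℝ) ^ (j - m) * (j.choose m : ℝ)),
    Finset.sum_range_succ' (fun m ↦ t ^ m * (-(a : ℝ)) ^ (j - m) * (j.choose m : ℝ))]
  simp only [pow_zero, one_mul, Nat.sub_zero, Nat.choose_zero_right, Nat.cast_one, mul_one]
  have hterm : ∀ p ∈ Finset.range j,
      ((((j.choose (p + 1) : ℕ) : ℚ) * ((-a) ^ (j - (p + 1)) - (-1) ^ (p + 1) * a ^ (j - (p + 1))) : ℚ) : ℝ) * t ^ (p + 1)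
        = t ^ (p + 1) * (-(a : ℝ)) ^ (j - (p + 1)) * (j.choose (p + 1) : ℝ)
          - (-t) ^ (p + 1) * (a : ℝ) ^ (j - (p + 1)) * (j.choose (p + 1) : ℝ) := by
    intro p _
    push_cast
    rw [neg_pow t]
    ring
  rw [Finset.sum_congr rfl hterm, Finset.sum_sub_distrib]
  ring

/-- The window integral of the bracket polynomial through the window constants: `∫ρ·B_j = Σ_{p<j} d_p W_{p+1}`. -/
theorem setIntegral_bracketPoly (a : ℚ) (ha : 0 < a) (j : ℕ) :
    ∫ t in Ioc 0 (2 * (a : ℝ)), weilArchDensity t * bracketPoly (a : ℝ) j t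
      = ∑ p ∈ Finset.range j, ((bracketCoeff a j p : ℚ) : ℝ) * ∫ t in Ioc 0 (2 * (a : ℝ)), weilArchDensity t * t ^ (p + 1) := by
  have ha' : (0 : ℝ) < a := by exact_mod_cast ha
  simp_rw [bracketPoly_eq_sum]
  exact setIntegral_weilArchDensity_mul_sum_pow_succ ha' j _

/-! ## Boxes of the bracket -/

/-- Box of the prime part `Σ_q Λ(q)q^{−1/2} P_j(a, ℓ_q)` from the prime weights and lengths of the constants record. -/
def primeKBox (S : ℕ) (C : Consts) (nks : ℕ) (a : ℚ) (j : ℕ) : MI :=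
  sumBox S (fun i ↦ (C.wts.getD i default).mul S
    (((ratBox S (2 * a ^ j - 2 * (-a) ^ j)).sub (powI S ((ratBox S a).sub (C.lens.getD i default)) j)).add
      (powI S ((C.lens.getD i default).sub (ratBox S a)) j))) nks

/-- `primeKBox ∋` the prime part of `K`. -/
theorem mem_primeKBox (hS : 0 < S) {a : ℚ} {ks : List PrimeLen} (hks : PrimeData (a : ℝ) ks) {C : Consts}
    (hC : ConstsValid S (a : ℝ) ks C) (j : ℕ) :
    MI.mem S (∑ n ∈ weilPrimeIndex (a : ℝ), (Λ n : ℝ) / Real.sqrt n * primePoly (a : ℝ) j (Real.log n))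
      (primeKBox S C ks.length a j) := by
  rw [WinPrime.sum_weilPrimeIndex_mul_eq_listSum hks (primePoly (a : ℝ) j), list_sum_map_eq_sum_range, primeKBox]
  refine mem_sumBox _ fun i hi ↦ MI.mem_mul hS (hC.wts i hi) ?_
  have hl := hC.lens i hi
  have hP : primePoly (a : ℝ) j (ks.getD i default).len
      = (((2 * a ^ j - 2 * (-a) ^ j : ℚ) : ℝ) - ((a : ℝ) - (ks.getD i default).len) ^ j)
          + ((ks.getD i default).len - (a : ℝ)) ^ j := by
    unfold primePoly; push_cast; ring
  rw [hP]
  exact MI.mem_add (MI.mem_sub (mem_ratBox S _) (mem_powI hS (MI.mem_sub (mem_ratBox S a) hl) j))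
    (mem_powI hS (MI.mem_sub hl (mem_ratBox S a)) j)

/-- Box of the archimedean window integral `∫_{(0,2a]} ρ B_j = Σ_{p<j} d_p W_{p+1}` through the table of window constants. -/
def archKBox (S : ℕ) (wt : List MI) (a : ℚ) (j : ℕ) : MI :=
  sumBox S (fun p ↦ mulRatBox (wtab wt (p + 1)) (bracketCoeff a j p)) j

/-- `archKBox ∋ ∫_{(0,2a]} ρ B_j` given a valid table of window constants up to `Q ≥ j`. -/
theorem mem_archKBox {a : ℚ} (ha : 0 < a) {wt : List MI} {Q : ℕ}
    (hW : ∀ l, 1 ≤ l → l ≤ Q → MI.mem S (∫ t in Ioc 0 (2 * (a : ℝ)), weilArchDensity t * t ^ l) (wtab wt l))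
    {j : ℕ} (hj : j ≤ Q) :
    MI.mem S (∫ t in Ioc 0 (2 * (a : ℝ)), weilArchDensity t * bracketPoly (a : ℝ) j t) (archKBox S wt a j) := by
  rw [setIntegral_bracketPoly a ha j, archKBox]
  refine mem_sumBox _ fun p hp ↦ ?_
  rw [mul_comm]
  exact mem_mulRatBox (hW (p + 1) (by omega) (by omega)) _

/-- **Box of the window bracket** `K = prime part + ∫ρB_j + (2T − M_a)(a^j − (−a)^j)`. -/
def kBox (S : ℕ) (C : Consts) (nks : ℕ) (wt : List MI) (T Mk : MI) (a : ℚ) (j : ℕ) : MI :=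
  ((primeKBox S C nks a j).add (archKBox S wt a j)).add (mulRatBox ((T.mulInt 2).sub Mk) (a ^ j - (-a) ^ j))

/-- **`kBox ∋ kReal a j`** from the certified constants, the window-constants table (`Q ≥ j`), the tail and the Markov constant. -/
theorem mem_kBox (hS : 0 < S) {a : ℚ} (ha : 0 < a) {ks : List PrimeLen} (hks : PrimeData (a : ℝ) ks) {C : Consts}
    (hC : ConstsValid S (a : ℝ) ks C) {wt : List MI} {Q : ℕ}
    (hW : ∀ l, 1 ≤ l → l ≤ Q → MI.mem S (∫ t in Ioc 0 (2 * (a : ℝ)), weilArchDensity t * t ^ l) (wtab wt l))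
    {T Mk : MI} (hT : MI.mem S (∫ t in Ioi (2 * (a : ℝ)), weilArchDensity t) T)
    (hMk : MI.mem S (weilMarkovConstant (a : ℝ)) Mk) {j : ℕ} (hj : j ≤ Q) :
    MI.mem S (kReal (a : ℝ) j) (kBox S C ks.length wt T Mk a j) := by
  unfold kReal kBox
  refine MI.mem_add (MI.mem_add (mem_primeKBox hS hks hC j) (mem_archKBox ha hW hj)) ?_
  have h := mem_mulRatBox (MI.mem_sub (MI.mem_mulInt hT 2) hMk) (a ^ j - (-a) ^ j)
  convert h using 1
  push_cast
  ring

/-- Box of the prime weight sum `Σ_n Λ(n)n^{−1/2}` (the `Lam` input of the row/image remainders). -/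
def lamBox (S : ℕ) (C : Consts) (nks : ℕ) : MI := sumBox S (fun i ↦ C.wts.getD i default) nks

/-- **`lamBox ∋ Σ_{n ∈ weilPrimeIndex a} Λ(n)/√n`**. -/
theorem mem_lamBox {a : ℚ} {ks : List PrimeLen} (hks : PrimeData (a : ℝ) ks) {C : Consts} (hC : ConstsValid S (a : ℝ) ks C) :
    MI.mem S (∑ n ∈ weilPrimeIndex (a : ℝ), (Λ n : ℝ) / Real.sqrt n) (lamBox S C ks.length) := by
  have h := WinPrime.sum_weilPrimeIndex_mul_eq_listSum hks (fun _ ↦ (1 : ℝ))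
  simp only [mul_one] at h
  rw [h, list_sum_map_eq_sum_range, lamBox]
  exact mem_sumBox _ fun i hi ↦ hC.wts i hi

/-! ## The constant `κ_c = ½log(π/2a) − ½Re ψ(¼) − D_{−1}` -/

/-- Box of `κ_c` from `log π` (constants record), boxes of `log 2`, `log a`, `Re ψ(¼)` and the tail `T = ∫_{(2a,∞)} ρ = D_{−1}`. -/
def kcBox (C : Consts) (L2 LA R0 T : MI) : MI :=
  ((((C.logPi.sub L2).sub LA).divNat 2).sub (R0.divNat 2)).sub T

/-- **`kcBox ∋ κ_c`**. -/
theorem mem_kcBox {a : ℚ} (ha : 0 < a) {ks : List PrimeLen} {C : Consts} (hC : ConstsValid S (a : ℝ) ks C)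
    {L2 LA R0 T : MI} (hL2 : MI.mem S (Real.log 2) L2) (hLA : MI.mem S (Real.log (a : ℝ)) LA)
    (hR0 : MI.mem S (reDigammaQuarter 0) R0) (hT : MI.mem S (∫ t in Ioi (2 * (a : ℝ)), weilArchDensity t) T) :
    MI.mem S (Real.log (π / (2 * (a : ℝ))) / 2 - reDigammaQuarter 0 / 2
        - ∑' l : ℕ, Real.exp (-(2 * (a : ℝ) * digammaNode l)) / digammaNode l) (kcBox C L2 LA R0 T) := by
  have ha' : (0 : ℝ) < a := by exact_mod_cast ha
  have hsum : ∑' l : ℕ, Real.exp (-(2 * (a : ℝ) * digammaNode l)) / digammaNode l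
      = ∫ t in Ioi (2 * (a : ℝ)), weilArchDensity t := by
    rw [← (hasSum_setIntegral_Ioi_weilArchDensity ha').tsum_eq]
    exact tsum_congr fun l ↦ by rw [mul_comm (2 * (a : ℝ)) (digammaNode l)]
  have hlog : Real.log (π / (2 * (a : ℝ))) = Real.log π - Real.log 2 - Real.log (a : ℝ) := by
    rw [Real.log_div Real.pi_pos.ne' (by positivity), Real.log_mul two_ne_zero ha'.ne']
    ring
  rw [hsum, hlog, kcBox]
  have h := MI.mem_sub (MI.mem_sub (MI.mem_divNat (MI.mem_sub (MI.mem_sub hC.logPi hL2) hLA) (n := 2) two_pos)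
    (MI.mem_divNat hR0 (n := 2) two_pos)) hT
  convert h using 1
  push_cast
  ring



open WinPole (coshMomBox mem_coshMomBox sinhMomBox mem_sinhMomBox)
open CinfCoeff (ImgInputs ImgInputsValid ImgInputsO ImgInputsValidO Kbracket KbracketO)


/-! ## The bracket lists -/

/-- `[Re(i^{k+1} K_{q,k})]_{k ≤ q}` boxed: `c_{k+1} · kBox(q − k)`. -/
def kreList (S : ℕ) (C : Consts) (nks : ℕ) (wt : List MI) (T Mk : MI) (a : ℚ) (q : ℕ) : List MI :=
  (List.range (q + 1)).map fun k ↦ mulRatBox (kBox S C nks wt T Mk a (q - k)) (CinfCoeff.cosQ (k + 1))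

/-- `[Im(i^{k+1} K_{q,k})]_{k ≤ q}` boxed: `σ_{k+1} · kBox(q − k)`. -/
def kimList (S : ℕ) (C : Consts) (nks : ℕ) (wt : List MI) (T Mk : MI) (a : ℚ) (q : ℕ) : List MI :=
  (List.range (q + 1)).map fun k ↦ mulRatBox (kBox S C nks wt T Mk a (q - k)) (CinfCoeff.sinQO (k + 1))

/-- Reading a `List.range … |>.map` table below its length. -/
private theorem getD_map_range {f : ℕ → MI} {n k : ℕ} (hk : k < n) :
    ((List.range n).map f).getD k default = f k := by
  rw [List.getD_eq_getElem?_getD, List.getElem?_map, List.getElem?_range hk, Option.map_some, Option.getD_some]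

variable {a : ℚ} {ks : List PrimeLen} {C : Consts} {wt : List MI} {Q : ℕ} {T Mk : MI}

/-- `kreList` encloses the real brackets. -/
theorem mem_kreList (hS : 0 < S) (ha : 0 < a) (hks : PrimeData (a : ℝ) ks) (hC : ConstsValid S (a : ℝ) ks C)
    (hW : ∀ l, 1 ≤ l → l ≤ Q → MI.mem S (∫ t in Ioc 0 (2 * (a : ℝ)), weilArchDensity t * t ^ l) (wtab wt l))
    (hT : MI.mem S (∫ t in Ioi (2 * (a : ℝ)), weilArchDensity t) T) (hMk : MI.mem S (weilMarkovConstant (a : ℝ)) Mk)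
    {q : ℕ} (hq : q ≤ Q) :
    ∀ k, k ≤ q → MI.mem S ((I ^ (k + 1) * Kbracket (a : ℝ) q k).re) ((kreList S C ks.length wt T Mk a q).getD k default) := by
  intro k hk
  rw [kreList, getD_map_range (by omega), re_I_pow_mul_Kbracket, mul_comm]
  exact mem_mulRatBox (mem_kBox hS ha hks hC hW hT hMk (by omega)) _

/-- `kimList` encloses the imaginary brackets. -/
theorem mem_kimList (hS : 0 < S) (ha : 0 < a) (hks : PrimeData (a : ℝ) ks) (hC : ConstsValid S (a : ℝ) ks C)
    (hW : ∀ l, 1 ≤ l → l ≤ Q → MI.mem S (∫ t in Ioc 0 (2 * (a : ℝ)), weilArchDensity t * t ^ l) (wtab wt l))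
    (hT : MI.mem S (∫ t in Ioi (2 * (a : ℝ)), weilArchDensity t) T) (hMk : MI.mem S (weilMarkovConstant (a : ℝ)) Mk)
    {q : ℕ} (hq : q ≤ Q) :
    ∀ k, k ≤ q → MI.mem S ((I ^ (k + 1) * KbracketO (a : ℝ) q k).im) ((kimList S C ks.length wt T Mk a q).getD k default) := by
  intro k hk
  rw [kimList, getD_map_range (by omega), im_I_pow_mul_KbracketO, mul_comm]
  exact mem_mulRatBox (mem_kBox hS ha hks hC hW hT hMk (by omega)) _

/-! ## The input records -/

/-- **Image inputs (even)** for the power `q`: constants from `C`, polar constant `4 C_q (e^{a/2} − e^{−a/2})`, `κ_c`, the real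
brackets, the Bernoulli table, the node moments. -/
def ofConsts (S : ℕ) (C : Consts) (Ep Em Kc : MI) (KRe Dl : List MI) (a : ℚ) (q : ℕ) : ImgInputs where
  P := C.P
  AP := C.A.mul S C.invPi
  A2P := (C.A.mul S C.invPi).divNat 2
  QQ := ((C.A.mul S C.invPi).divNat 2).sqr S
  Pol := ((coshMomBox Ep Em a q).mul S (Ep.sub Em)).mulInt 4
  Kc := Kc
  KRe := KRe
  bt := MC.bernoulliTable42
  Dl := Dl

/-- **Image inputs (odd)** for the power `q`: as `ofConsts` with the polar constant `−8 S_q (e^{a/2} − e^{−a/2})` and the imaginary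
brackets. -/
def ofConstsO (S : ℕ) (C : Consts) (Ep Em Kc : MI) (KIm Dl : List MI) (a : ℚ) (q : ℕ) : ImgInputsO where
  P := C.P
  AP := C.A.mul S C.invPi
  A2P := (C.A.mul S C.invPi).divNat 2
  QQ := ((C.A.mul S C.invPi).divNat 2).sqr S
  Pol := ((sinhMomBox Ep Em a q).mul S (Ep.sub Em)).mulInt (-8)
  Kc := Kc
  KRe := KIm
  bt := MC.bernoulliTable42
  Dl := Dl

variable {Ep Em Kc : MI} {Dl : List MI} {ν Rr : ℕ}

/-- ★ **Validity (even).** -/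
theorem valid_ofConsts (hS : 0 < S) (hC : ConstsValid S (a : ℝ) ks C)
    (hEp : MI.mem S (Real.exp ((a : ℝ) / 2)) Ep) (hEm : MI.mem S (Real.exp (-((a : ℝ) / 2))) Em)
    (hKc : MI.mem S (Real.log (π / (2 * (a : ℝ))) / 2 - reDigammaQuarter 0 / 2
        - ∑' l : ℕ, Real.exp (-(2 * (a : ℝ) * digammaNode l)) / digammaNode l) Kc)
    {KRe : List MI} {q : ℕ} (hKRe : ∀ k, k ≤ q → MI.mem S ((I ^ (k + 1) * Kbracket (a : ℝ) q k).re) (KRe.getD k default))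
    (hD : ∀ s, s ≤ 2 * Rr + 1 →
      MI.mem S (∑' k : ℕ, Real.exp (-(2 * (a : ℝ) * digammaNode k)) * digammaNode k ^ s) (Dl.getD s default))
    (hν : ν ≤ 21) :
    ImgInputsValid S a q ν Rr (ofConsts S C Ep Em Kc KRe Dl a q) where
  hP := hC.pi
  hAP := by
    have h := MI.mem_mul hS hC.ha hC.invPi
    exact Encl.mem_of_eq h (by ring)
  hA2P := by
    have h := MI.mem_divNat (MI.mem_mul hS hC.ha hC.invPi) (n := 2) (by norm_num)
    exact Encl.mem_of_eq h (by push_cast; ring)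
  hQQ := by
    have h := MI.mem_sqr hS (MI.mem_divNat (MI.mem_mul hS hC.ha hC.invPi) (n := 2) (by norm_num))
    exact Encl.mem_of_eq h (by push_cast; ring)
  hPol := by
    have h := MI.mem_mulInt (MI.mem_mul hS (mem_coshMomBox hEp hEm q) (MI.mem_sub hEp hEm)) 4
    exact Encl.mem_of_eq h (by push_cast; ring)
  hKc := hKc
  hKRe := hKRe
  hbt := fun k hk ↦ MC.bernoulliTable42_getD (by omega)
  hD := hD

/-- ★ **Validity (odd).** -/
theorem valid_ofConstsO (hS : 0 < S) (hC : ConstsValid S (a : ℝ) ks C)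
    (hEp : MI.mem S (Real.exp ((a : ℝ) / 2)) Ep) (hEm : MI.mem S (Real.exp (-((a : ℝ) / 2))) Em)
    (hKc : MI.mem S (Real.log (π / (2 * (a : ℝ))) / 2 - reDigammaQuarter 0 / 2
        - ∑' l : ℕ, Real.exp (-(2 * (a : ℝ) * digammaNode l)) / digammaNode l) Kc)
    {KIm : List MI} {q : ℕ} (hKIm : ∀ k, k ≤ q → MI.mem S ((I ^ (k + 1) * KbracketO (a : ℝ) q k).im) (KIm.getD k default))
    (hD : ∀ s, s ≤ 2 * Rr + 1 →
      MI.mem S (∑' k : ℕ, Real.exp (-(2 * (a : ℝ) * digammaNode k)) * digammaNode k ^ s) (Dl.getD s default))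
    (hν : ν ≤ 21) :
    ImgInputsValidO S a q ν Rr (ofConstsO S C Ep Em Kc KIm Dl a q) where
  hP := hC.pi
  hAP := by
    have h := MI.mem_mul hS hC.ha hC.invPi
    exact Encl.mem_of_eq h (by ring)
  hA2P := by
    have h := MI.mem_divNat (MI.mem_mul hS hC.ha hC.invPi) (n := 2) (by norm_num)
    exact Encl.mem_of_eq h (by push_cast; ring)
  hQQ := by
    have h := MI.mem_sqr hS (MI.mem_divNat (MI.mem_mul hS hC.ha hC.invPi) (n := 2) (by norm_num))
    exact Encl.mem_of_eq h (by push_cast; ring)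
  hPol := by
    have h := MI.mem_mulInt (MI.mem_mul hS (mem_sinhMomBox hEp hEm q) (MI.mem_sub hEp hEm)) (-8)
    exact Encl.mem_of_eq h (by push_cast; ring)
  hKc := hKc
  hKRe := hKIm
  hbt := fun k hk ↦ MC.bernoulliTable42_getD (by omega)
  hD := hD

/-! ## The complete producer: every input from the kit objects -/

/-- ★ **All image inputs at once (even)**, stated as the pipeline validators consume them: from the constants, `e^{±a/2}`, the
window-constants table (orders `≤ Q`, `q ≤ Q`), the tail, the Markov constant, `log 2`, `log a`, `Re ψ(¼)`, and the node-moment list. -/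
theorem valid_even (hS : 0 < S) (ha : 0 < a) (hks : PrimeData (a : ℝ) ks) (hC : ConstsValid S (a : ℝ) ks C)
    (hEp : MI.mem S (Real.exp ((a : ℝ) / 2)) Ep) (hEm : MI.mem S (Real.exp (-((a : ℝ) / 2))) Em)
    (hW : ∀ l, 1 ≤ l → l ≤ Q → MI.mem S (∫ t in Ioc 0 (2 * (a : ℝ)), weilArchDensity t * t ^ l) (wtab wt l))
    (hT : MI.mem S (∫ t in Ioi (2 * (a : ℝ)), weilArchDensity t) T) (hMk : MI.mem S (weilMarkovConstant (a : ℝ)) Mk)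
    {L2 LA R0 : MI} (hL2 : MI.mem S (Real.log 2) L2) (hLA : MI.mem S (Real.log (a : ℝ)) LA)
    (hR0 : MI.mem S (reDigammaQuarter 0) R0)
    (hD : ∀ s, s ≤ 2 * Rr + 1 →
      MI.mem S (∑' k : ℕ, Real.exp (-(2 * (a : ℝ) * digammaNode k)) * digammaNode k ^ s) (Dl.getD s default))
    (hν : ν ≤ 21) {q : ℕ} (hq : q ≤ Q) :
    ImgInputsValid S a q ν Rr
      (ofConsts S C Ep Em (kcBox C L2 LA R0 T) (kreList S C ks.length wt T Mk a q) Dl a q) :=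
  valid_ofConsts hS hC hEp hEm (mem_kcBox ha hC hL2 hLA hR0 hT) (mem_kreList hS ha hks hC hW hT hMk hq) hD hν

/-- ★ **All image inputs at once (odd).** -/
theorem valid_odd (hS : 0 < S) (ha : 0 < a) (hks : PrimeData (a : ℝ) ks) (hC : ConstsValid S (a : ℝ) ks C)
    (hEp : MI.mem S (Real.exp ((a : ℝ) / 2)) Ep) (hEm : MI.mem S (Real.exp (-((a : ℝ) / 2))) Em)
    (hW : ∀ l, 1 ≤ l → l ≤ Q → MI.mem S (∫ t in Ioc 0 (2 * (a : ℝ)), weilArchDensity t * t ^ l) (wtab wt l))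
    (hT : MI.mem S (∫ t in Ioi (2 * (a : ℝ)), weilArchDensity t) T) (hMk : MI.mem S (weilMarkovConstant (a : ℝ)) Mk)
    {L2 LA R0 : MI} (hL2 : MI.mem S (Real.log 2) L2) (hLA : MI.mem S (Real.log (a : ℝ)) LA)
    (hR0 : MI.mem S (reDigammaQuarter 0) R0)
    (hD : ∀ s, s ≤ 2 * Rr + 1 →
      MI.mem S (∑' k : ℕ, Real.exp (-(2 * (a : ℝ) * digammaNode k)) * digammaNode k ^ s) (Dl.getD s default))
    (hν : ν ≤ 21) {q : ℕ} (hq : q ≤ Q) :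
    ImgInputsValidO S a q ν Rr
      (ofConstsO S C Ep Em (kcBox C L2 LA R0 T) (kimList S C ks.length wt T Mk a q) Dl a q) :=
  valid_ofConstsO hS hC hEp hEm (mem_kcBox ha hC hL2 hLA hR0 hT) (mem_kimList hS ha hks hC hW hT hMk hq) hD hν

end CinfImgIn

end Summit.RiemannHypothesis.RiemannHypothesis.Theorems.WeilFormatC
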